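import Mathlib
import Summits.KontsevichZagierPeriods.KontsevichZagierPeriods.Theses.InverseLandau
import Literature.NumberTheory.Transcendental.KZCalculus
import Literature.NumberTheory.Transcendental.KZLogCalculusProofs
import Literature.NumberTheory.Transcendental.KZProductIdeal
import Literature.NumberTheory.Transcendental.KZMellinFibres
import Literature.NumberTheory.Transcendental.KZDominatedFamilyRelations

/-!
# `TateLifting` (stmt-KontsevichZagierPeriods-9129), line `Sketch`, stub `stub_parabolaDescends`:
# `[(0,1)², 1/(y − x² − 5)]` descends to two one-dimensional representations INSIDE the rules

Crux `Summit.KontsevichZagierPeriods.KontsevichZagierPeriods.Theses.InverseLandau.TateLifting`,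
elementary-moves sector; the statement proved here (`tateLifting_parabolaDescends`) is verbatim the
open item `ParabolaDescends` (stmt-KontsevichZagierPeriods-4431) of route `GenericPointClass`:
for `r = [(0,1)², 1/(y − x² − 5)]` (coordinates `x = z 0`, `y = z 1`), `s₀ = [(0,1), 1/(y − 6)]` and
`s₁ = [(0,1), 2y²(1/(y²+5) − 1/(y²+4))]`, pinned by their domains and by their integrands ON the
domains, `[r] − [s₀] − [s₁] ∈ KZ.relations`.

This is an integration by parts carried out with Kontsevich–Zagier's rules (1)–(3) only (the four
moves of `Literature/NumberTheory/Transcendental/KZCalculus.lean`). With `H = y − x² − 5` (`H ≤ −4`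
once `y ≤ 1`, so every function below is a quotient of `ℚ`-polynomials with non-vanishing
denominator: `ℚ`-semialgebraic, and continuous on the closed unit square):

* integrand additivity (rule 1): `1/H = (1/H + 2x²/H²) + (−2x²/H²)` on the open square;
* `−2x²/H² = ∂_y (2x²/H)`: on the band `(0,1) × [0,1]` (last coordinate `y`) ONE Newton–Leibniz
  move (rule 3) with the primitive `2x²/H` lands on `[(0,1), 2x²(1/(x²+5) − 1/(x²+4))]`
  (`ParabolaDescends.piece₂`);
* `1/H + 2x²/H² = ∂ₓ (x/H)`: after relabelling the two coordinates (rule 2,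
  `KZ.of_sub_of_reindex_mem_relations` with `Equiv.swap 0 1`) `x` is the last coordinate, and ONE
  Newton–Leibniz move with the primitive `x/H` lands on `[(0,1), 1/(y − 6)]`
  (`ParabolaDescends.piece₁`);
* open square ↔ band (two null faces `{y = 0}`, `{y = 1}`) is domain additivity with a null piece
  (`KZ.IntegralRep.of_sub_of_restrict_mem_relations`), and the pinned `r, s₀, s₁` are exchanged for
  the explicit representations by congruence (`KZ.of_sub_of_mem_relations_of_eqOn`).

No named fact is assumed and no definition is introduced. Reference: M. Kontsevich, D. Zagier,
*Periods* (2001), §1.2, rules (1)–(3).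
-/

noncomputable section

open MeasureTheory Set
open Literature.NumberTheory.Transcendental
open Literature.ModelTheory.ExponentialFields (IsSemialgebraic)

namespace Summit.KontsevichZagierPeriods.InverseLandau

namespace ParabolaDescends

/-- The open unit interval of `ℝ¹` is `ℚ`-semialgebraic. [folklore] -/
theorem isSemialgebraic_interval :
    IsSemialgebraic ℚ {y : Fin 1 → ℝ | ∀ i, y i ∈ Set.Ioo (0:ℝ) 1} :=
  KZ.isSemialgebraic_box 1

/-- The open unit square of `ℝ²` is `ℚ`-semialgebraic. [folklore] -/
theorem isSemialgebraic_square :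
    IsSemialgebraic ℚ {z : Fin 2 → ℝ | ∀ i, z i ∈ Set.Ioo (0:ℝ) 1} :=
  KZ.isSemialgebraic_box 2

/-- The constant edge `0` is `ℚ`-semialgebraic on the open unit interval. [folklore] -/
theorem isSemialgebraicFunOn_zero :
    IsSemialgebraicFunOn ℚ {y : Fin 1 → ℝ | ∀ i, y i ∈ Set.Ioo (0:ℝ) 1} (fun _ => (0:ℝ)) := by
  simpa using isSemialgebraicFunOn_ratCast isSemialgebraic_interval 0

/-- The constant edge `1` is `ℚ`-semialgebraic on the open unit interval. [folklore] -/
theorem isSemialgebraicFunOn_one :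
    IsSemialgebraicFunOn ℚ {y : Fin 1 → ℝ | ∀ i, y i ∈ Set.Ioo (0:ℝ) 1} (fun _ => (1:ℝ)) := by
  simpa using isSemialgebraicFunOn_ratCast isSemialgebraic_interval 1

/-- The band `(0,1) × [0,1]` is `ℚ`-semialgebraic. [folklore] -/
theorem isSemialgebraic_strip :
    IsSemialgebraic ℚ (KZlog.band {y : Fin 1 → ℝ | ∀ i, y i ∈ Set.Ioo (0:ℝ) 1}
      (fun _ => (0:ℝ)) (fun _ => (1:ℝ)) : Set (Fin 2 → ℝ)) :=
  KZlog.isSemialgebraic_band isSemialgebraicFunOn_zero isSemialgebraicFunOn_one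

/-- Membership in the band `(0,1) × [0,1]`, in coordinates. [folklore] -/
theorem mem_strip_iff {z : Fin 2 → ℝ} :
    z ∈ (KZlog.band {y : Fin 1 → ℝ | ∀ i, y i ∈ Set.Ioo (0:ℝ) 1} (fun _ => (0:ℝ))
      (fun _ => (1:ℝ)) : Set (Fin 2 → ℝ)) ↔ z 0 ∈ Set.Ioo (0:ℝ) 1 ∧ z 1 ∈ Set.Icc (0:ℝ) 1 := by
  simp only [KZlog.mem_band, mem_setOf_eq, Fin.forall_fin_one, mem_Icc]
  exact Iff.rfl

/-- The open square lies in the band. [folklore] -/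
theorem square_subset_strip :
    {z : Fin 2 → ℝ | ∀ i, z i ∈ Set.Ioo (0:ℝ) 1} ⊆ (KZlog.band
      {y : Fin 1 → ℝ | ∀ i, y i ∈ Set.Ioo (0:ℝ) 1} (fun _ => (0:ℝ)) (fun _ => (1:ℝ)) :
        Set (Fin 2 → ℝ)) := fun _ hz =>
  mem_strip_iff.2 ⟨hz 0, Ioo_subset_Icc_self (hz 1)⟩

/-- The band lies in the closed unit square `[0,1]²` (order interval of `Fin 2 → ℝ`). [folklore] -/
theorem strip_subset_Icc :
    (KZlog.band {y : Fin 1 → ℝ | ∀ i, y i ∈ Set.Ioo (0:ℝ) 1} (fun _ => (0:ℝ)) (fun _ => (1:ℝ)) :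
      Set (Fin 2 → ℝ)) ⊆ Icc (0 : Fin 2 → ℝ) 1 := fun z hz => by
  obtain ⟨h0, h1⟩ := mem_strip_iff.1 hz
  have key : ∀ i : Fin 2, (0 : ℝ) ≤ z i ∧ z i ≤ 1 :=
    Fin.forall_fin_two.2 ⟨⟨h0.1.le, h0.2.le⟩, h1.1, h1.2⟩
  exact ⟨fun i => (key i).1, fun i => (key i).2⟩

/-- The open unit interval lies in the closed one (order interval of `Fin 1 → ℝ`). [folklore] -/
theorem interval_subset_Icc :
    {y : Fin 1 → ℝ | ∀ i, y i ∈ Set.Ioo (0:ℝ) 1} ⊆ Icc (0 : Fin 1 → ℝ) 1 := fun y hy => by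
  simp only [mem_Icc, Pi.le_def, Pi.zero_apply, Pi.one_apply, Fin.forall_fin_one]
  exact ⟨(hy 0).1.le, (hy 0).2.le⟩

/-- The band minus the open square consists of the two faces `{y = 0}`, `{y = 1}`, which are
Lebesgue-null. [folklore] -/
theorem volume_strip_diff_square :
    volume ((KZlog.band {y : Fin 1 → ℝ | ∀ i, y i ∈ Set.Ioo (0:ℝ) 1} (fun _ => (0:ℝ))
      (fun _ => (1:ℝ)) : Set (Fin 2 → ℝ)) \ {z : Fin 2 → ℝ | ∀ i, z i ∈ Set.Ioo (0:ℝ) 1}) = 0 := by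
  refine measure_mono_null (t := {z : Fin 2 → ℝ | z (Fin.last 1) = 0} ∪ {z | z (Fin.last 1) = 1})
    ?_ (measure_union_null (KZ.volume_setOf_last_eq_zero _) (KZ.volume_setOf_last_eq_zero _))
  rintro z ⟨hzB, hzS⟩
  obtain ⟨h0, h1⟩ := mem_strip_iff.1 hzB
  have h1' : z 1 ∉ Set.Ioo (0:ℝ) 1 := fun h => hzS (Fin.forall_fin_two.2 ⟨h0, h⟩)
  rcases h1.1.eq_or_lt with h | h
  · exact Or.inl h.symm
  · exact Or.inr (le_antisymm h1.2 (not_lt.1 fun h' => h1' ⟨h, h'⟩))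

/-- A function continuous on the compact cube `[0,1]ᴺ` is integrable on every subset of it.
[folklore] -/
theorem integrableOn_of_continuousOn_Icc {N : ℕ} {f : (Fin N → ℝ) → ℝ} {A : Set (Fin N → ℝ)}
    (hf : ContinuousOn f (Icc 0 1)) (hA : A ⊆ Icc 0 1) : IntegrableOn f A :=
  (hf.integrableOn_compact isCompact_Icc).mono_set hA

/-- The denominator `t − x² − 5 ≤ −4` does not vanish as soon as `t ≤ 1`. [folklore] -/
theorem den_ne_zero (x : ℝ) {t : ℝ} (ht : t ≤ 1) : t - x ^ 2 - 5 ≠ 0 :=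
  (show t - x ^ 2 - 5 < 0 by nlinarith [sq_nonneg x]).ne

/-- **First piece: `[(0,1)², 1/H + 2x²/H²] − [s₀] ∈ relations`** (`H = y − x² − 5`) for every
`s₀` pinned as `[(0,1), 1/(y − 6)]`. Relabel the coordinates (rule 2), so that `x` is the last
coordinate), pass to the band `(0,1) × [0,1]` (two null faces, rule 1), and apply ONE
Newton–Leibniz move (rule 3) with the primitive `x/H`: `∂ₓ (x/H) = 1/H + 2x²/H²` and
`[x/H]₀¹ = 1/(y − 6)`. [cite: KontsevichZagier2001, §1.2] -/
theorem piece₁ :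
    ∃ R₁ : KZ.IntegralRep 2, R₁.domain = {z : Fin 2 → ℝ | ∀ i, z i ∈ Set.Ioo (0:ℝ) 1} ∧
      R₁.integrand = (fun z => 1 / (z 1 - z 0 ^ 2 - 5) + 2 * z 0 ^ 2 / (z 1 - z 0 ^ 2 - 5) ^ 2) ∧
      ∀ s₀ : KZ.IntegralRep 1, s₀.domain = {y : Fin 1 → ℝ | ∀ i, y i ∈ Set.Ioo (0:ℝ) 1} →
        EqOn s₀.integrand (fun y => 1 / (y 0 - 6)) s₀.domain →
          KZ.of R₁ - KZ.of s₀ ∈ KZ.relations := by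
  set B : Set (Fin 2 → ℝ) := KZlog.band {y : Fin 1 → ℝ | ∀ i, y i ∈ Set.Ioo (0:ℝ) 1}
    (fun _ => (0:ℝ)) (fun _ => (1:ℝ))
  -- `R₁ = [(0,1)², 1/H + 2x²/H²]`
  have hg₁ : IsSemialgebraicFunOn ℚ {z : Fin 2 → ℝ | ∀ i, z i ∈ Set.Ioo (0:ℝ) 1}
      (fun z => 1 / (z 1 - z 0 ^ 2 - 5) + 2 * z 0 ^ 2 / (z 1 - z 0 ^ 2 - 5) ^ 2) := by
    refine (isSemialgebraicFunOn_aeval_div_aeval isSemialgebraic_square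
      (MvPolynomial.X 1 - MvPolynomial.X 0 ^ 2 - 5 + 2 * MvPolynomial.X 0 ^ 2 :
        MvPolynomial (Fin 2) ℚ)
      ((MvPolynomial.X 1 - MvPolynomial.X 0 ^ 2 - 5) ^ 2) fun z hz => ?_).congr fun z hz => ?_
    · simpa using pow_ne_zero 2 (den_ne_zero (z 0) (hz 1).2.le)
    · have h := den_ne_zero (z 0) (hz 1).2.le
      simp only [map_add, map_sub, map_mul, map_pow, MvPolynomial.aeval_X, map_ofNat]
      field_simp
  have hc₁ : ContinuousOn
      (fun z : Fin 2 → ℝ => 1 / (z 1 - z 0 ^ 2 - 5) + 2 * z 0 ^ 2 / (z 1 - z 0 ^ 2 - 5) ^ 2)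
      (Icc 0 1) :=
    (continuousOn_const.div (by fun_prop) fun z hz => den_ne_zero (z 0) (hz.2 1)).add
      (ContinuousOn.div (by fun_prop) (by fun_prop)
        fun z hz => pow_ne_zero 2 (den_ne_zero (z 0) (hz.2 1)))
  obtain ⟨R₁, hR₁d, hR₁i⟩ : ∃ R₁ : KZ.IntegralRep 2,
      R₁.domain = {z : Fin 2 → ℝ | ∀ i, z i ∈ Set.Ioo (0:ℝ) 1} ∧
      R₁.integrand = fun z => 1 / (z 1 - z 0 ^ 2 - 5) + 2 * z 0 ^ 2 / (z 1 - z 0 ^ 2 - 5) ^ 2 :=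
    ⟨⟨_, _, isSemialgebraic_square, hg₁, integrableOn_of_continuousOn_Icc hc₁
      (square_subset_strip.trans strip_subset_Icc)⟩, rfl, rfl⟩
  -- the same integrand in the swapped coordinates `w = (y, x)`, on the band: `R' = [B, 1/H + 2x²/H²]`
  have hg' : IsSemialgebraicFunOn ℚ B
      (fun w => 1 / (w 0 - w 1 ^ 2 - 5) + 2 * w 1 ^ 2 / (w 0 - w 1 ^ 2 - 5) ^ 2) := by
    refine (isSemialgebraicFunOn_aeval_div_aeval isSemialgebraic_strip
      (MvPolynomial.X 0 - MvPolynomial.X 1 ^ 2 - 5 + 2 * MvPolynomial.X 1 ^ 2 :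
        MvPolynomial (Fin 2) ℚ)
      ((MvPolynomial.X 0 - MvPolynomial.X 1 ^ 2 - 5) ^ 2) fun w hw => ?_).congr fun w hw => ?_
    · simpa using pow_ne_zero 2 (den_ne_zero (w 1) (mem_strip_iff.1 hw).1.2.le)
    · have h := den_ne_zero (w 1) (mem_strip_iff.1 hw).1.2.le
      simp only [map_add, map_sub, map_mul, map_pow, MvPolynomial.aeval_X, map_ofNat]
      field_simp
  have hc' : ContinuousOn
      (fun w : Fin 2 → ℝ => 1 / (w 0 - w 1 ^ 2 - 5) + 2 * w 1 ^ 2 / (w 0 - w 1 ^ 2 - 5) ^ 2)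
      (Icc 0 1) :=
    (continuousOn_const.div (by fun_prop) fun w hw => den_ne_zero (w 1) (hw.2 0)).add
      (ContinuousOn.div (by fun_prop) (by fun_prop)
        fun w hw => pow_ne_zero 2 (den_ne_zero (w 1) (hw.2 0)))
  obtain ⟨R', hR'd, hR'i⟩ : ∃ R' : KZ.IntegralRep 2, R'.domain = B ∧
      R'.integrand = fun w => 1 / (w 0 - w 1 ^ 2 - 5) + 2 * w 1 ^ 2 / (w 0 - w 1 ^ 2 - 5) ^ 2 :=
    ⟨⟨_, _, isSemialgebraic_strip, hg', integrableOn_of_continuousOn_Icc hc' strip_subset_Icc⟩,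
      rfl, rfl⟩
  -- the honest base representation `T = [(0,1), 1/(y − 6)]`
  have hh : IsSemialgebraicFunOn ℚ {y : Fin 1 → ℝ | ∀ i, y i ∈ Set.Ioo (0:ℝ) 1}
      (fun y => 1 / (y 0 - 6)) := by
    refine (isSemialgebraicFunOn_aeval_div_aeval isSemialgebraic_interval
      (1 : MvPolynomial (Fin 1) ℚ) (MvPolynomial.X 0 - 6) fun y hy => ?_).congr fun y _ => ?_
    · simpa using (show y 0 - 6 < 0 by linarith [(hy 0).2]).ne
    · simp
  have hcT : ContinuousOn (fun y : Fin 1 → ℝ => 1 / (y 0 - 6)) (Icc 0 1) :=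
    continuousOn_const.div (by fun_prop) fun y hy => by
      have h1 : y 0 ≤ 1 := hy.2 0; exact (show y 0 - 6 < 0 by linarith).ne
  obtain ⟨T, hTd, hTi⟩ : ∃ T : KZ.IntegralRep 1,
      T.domain = {y : Fin 1 → ℝ | ∀ i, y i ∈ Set.Ioo (0:ℝ) 1} ∧
      T.integrand = fun y => 1 / (y 0 - 6) :=
    ⟨⟨_, _, isSemialgebraic_interval, hh, integrableOn_of_continuousOn_Icc hcT interval_subset_Icc⟩,
      rfl, rfl⟩
  -- the primitive `x/H`, in the swapped coordinates: `F w = w 1/(w 0 − w 1² − 5)`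
  have hF : IsSemialgebraicFunOn ℚ B (fun w => w 1 / (w 0 - w 1 ^ 2 - 5)) := by
    refine (isSemialgebraicFunOn_aeval_div_aeval isSemialgebraic_strip
      (MvPolynomial.X 1 : MvPolynomial (Fin 2) ℚ) (MvPolynomial.X 0 - MvPolynomial.X 1 ^ 2 - 5)
      fun w hw => ?_).congr fun w _ => ?_
    · simpa using den_ne_zero (w 1) (mem_strip_iff.1 hw).1.2.le
    · simp
  -- ONE Newton–Leibniz move along the last coordinate: `[R'] − [T]`
  have hNL : KZ.of R' - KZ.of T ∈ KZ.relations := by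
    refine KZ.newtonLeibnizRel_subset_relations ⟨1, R', T, fun _ => 0, fun _ => 1,
      fun w => w 1 / (w 0 - w 1 ^ 2 - 5), by rw [hR'd]; exact hF,
      by rw [hTd]; exact isSemialgebraicFunOn_zero, by rw [hTd]; exact isSemialgebraicFunOn_one,
      fun _ _ => zero_le_one, by rw [hR'd, hTd]; rfl, fun y hy => ?_, fun y hy s _ => ?_,
      fun y _ => ?_, rfl⟩
    · -- continuity of `s ↦ F (y, s)` on `[0, 1]`
      rw [hTd] at hy
      show ContinuousOn (fun s : ℝ => s / (y 0 - s ^ 2 - 5)) (Icc 0 1)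
      exact continuousOn_id.div (by fun_prop) fun s _ => den_ne_zero s (hy 0).2.le
    · -- `∂ₛ F (y, s) = 1/(y − s² − 5) + 2s²/(y − s² − 5)²`
      rw [hTd] at hy
      rw [hR'i]
      show HasDerivAt (fun s : ℝ => s / (y 0 - s ^ 2 - 5))
        (1 / (y 0 - s ^ 2 - 5) + 2 * s ^ 2 / (y 0 - s ^ 2 - 5) ^ 2) s
      have h2 : HasDerivAt (fun s : ℝ => s ^ 2) (2 * s) s := by simpa using hasDerivAt_pow 2 s
      have hE : HasDerivAt (fun s : ℝ => y 0 - s ^ 2 - 5) (-(2 * s)) s := by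
        simpa using (h2.const_sub (y 0)).sub_const 5
      have hne := den_ne_zero s (hy 0).2.le
      refine ((hasDerivAt_id' s).div hE hne).congr_deriv ?_
      field_simp
      ring
    · -- the boundary term `F (y, 1) − F (y, 0) = 1/(y − 6)`
      rw [hTi]
      show 1 / (y 0 - 6) = 1 / (y 0 - 1 ^ 2 - 5) - 0 / (y 0 - 0 ^ 2 - 5)
      ring
  -- relabelling the coordinates of `R₁` (rule 2) lands on `R'` restricted to the open square
  have hSR' : {z : Fin 2 → ℝ | ∀ i, z i ∈ Set.Ioo (0:ℝ) 1} ⊆ R'.domain := by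
    rw [hR'd]; exact square_subset_strip
  have hsw : KZ.of R₁ - KZ.of (R₁.reindex (Equiv.swap (0 : Fin 2) 1)) ∈ KZ.relations :=
    KZ.of_sub_of_reindex_mem_relations R₁ _
  have hcg : KZ.of (R₁.reindex (Equiv.swap (0 : Fin 2) 1)) -
      KZ.of (R'.restrict _ isSemialgebraic_square hSR') ∈ KZ.relations := by
    refine KZ.of_sub_of_mem_relations_of_eqOn ?_ fun w _ => ?_
    · rw [KZ.IntegralRep.domain_restrict, KZ.IntegralRep.reindex_domain, hR₁d]
      ext w
      simp only [mem_setOf_eq, Fin.forall_fin_two, Equiv.swap_apply_left, Equiv.swap_apply_right]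
      exact and_comm
    · rw [KZ.IntegralRep.reindex_integrand, KZ.IntegralRep.integrand_restrict, hR₁i, hR'i]
      simp only [Equiv.swap_apply_left, Equiv.swap_apply_right]
  -- the two null faces of the band
  have hnull : KZ.of R' - KZ.of (R'.restrict _ isSemialgebraic_square hSR') ∈ KZ.relations :=
    R'.of_sub_of_restrict_mem_relations isSemialgebraic_square hSR'
      (by rw [hR'd]; exact volume_strip_diff_square)
  refine ⟨R₁, hR₁d, hR₁i, fun s₀ hs₀d hs₀i => ?_⟩
  -- exchange the pinned `s₀` for the explicit `T`
  have h0 : KZ.of s₀ - KZ.of T ∈ KZ.relations :=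
    KZ.of_sub_of_mem_relations_of_eqOn (by rw [hTd, hs₀d]) (by rw [hTi]; exact hs₀i)
  have : KZ.of R₁ - KZ.of s₀ = (KZ.of R₁ - KZ.of (R₁.reindex (Equiv.swap (0 : Fin 2) 1))) +
      (KZ.of (R₁.reindex (Equiv.swap (0 : Fin 2) 1)) -
        KZ.of (R'.restrict _ isSemialgebraic_square hSR')) -
      (KZ.of R' - KZ.of (R'.restrict _ isSemialgebraic_square hSR')) + (KZ.of R' - KZ.of T) -
      (KZ.of s₀ - KZ.of T) := by abel
  rw [this]
  exact KZ.relations.sub_mem (KZ.relations.add_mem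
    (KZ.relations.sub_mem (KZ.relations.add_mem hsw hcg) hnull) hNL) h0

/-- **Second piece: `[(0,1)², −2x²/H²] − [s₁] ∈ relations`** (`H = y − x² − 5`) for every `s₁`
pinned as `[(0,1), 2x²(1/(x²+5) − 1/(x²+4))]`. Pass to the band `(0,1) × [0,1]` (two null faces,
rule 1) and apply ONE Newton–Leibniz move (rule 3) along `y` with the primitive `2x²/H`:
`∂_y (2x²/H) = −2x²/H²` and `[2x²/H]₀¹ = 2x²/(−4 − x²) − 2x²/(−5 − x²) = 2x²(1/(x²+5) − 1/(x²+4))`.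
[cite: KontsevichZagier2001, §1.2] -/
theorem piece₂ :
    ∃ R₂ : KZ.IntegralRep 2, R₂.domain = {z : Fin 2 → ℝ | ∀ i, z i ∈ Set.Ioo (0:ℝ) 1} ∧
      R₂.integrand = (fun z => -(2 * z 0 ^ 2) / (z 1 - z 0 ^ 2 - 5) ^ 2) ∧
      ∀ s₁ : KZ.IntegralRep 1, s₁.domain = {y : Fin 1 → ℝ | ∀ i, y i ∈ Set.Ioo (0:ℝ) 1} →
        EqOn s₁.integrand (fun y => 2 * y 0 ^ 2 * (1 / (y 0 ^ 2 + 5) - 1 / (y 0 ^ 2 + 4)))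
          s₁.domain → KZ.of R₂ - KZ.of s₁ ∈ KZ.relations := by
  set B : Set (Fin 2 → ℝ) := KZlog.band {y : Fin 1 → ℝ | ∀ i, y i ∈ Set.Ioo (0:ℝ) 1}
    (fun _ => (0:ℝ)) (fun _ => (1:ℝ))
  -- the band representation `R = [B, −2x²/H²]`
  have hg : IsSemialgebraicFunOn ℚ B (fun z => -(2 * z 0 ^ 2) / (z 1 - z 0 ^ 2 - 5) ^ 2) := by
    refine (isSemialgebraicFunOn_aeval_div_aeval isSemialgebraic_strip
      (-(2 * MvPolynomial.X 0 ^ 2) : MvPolynomial (Fin 2) ℚ)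
      ((MvPolynomial.X 1 - MvPolynomial.X 0 ^ 2 - 5) ^ 2) fun z hz => ?_).congr fun z _ => ?_
    · simpa using pow_ne_zero 2 (den_ne_zero (z 0) (mem_strip_iff.1 hz).2.2)
    · simp
  have hc : ContinuousOn (fun z : Fin 2 → ℝ => -(2 * z 0 ^ 2) / (z 1 - z 0 ^ 2 - 5) ^ 2)
      (Icc 0 1) :=
    ContinuousOn.div (by fun_prop) (by fun_prop)
      fun z hz => pow_ne_zero 2 (den_ne_zero (z 0) (hz.2 1))
  obtain ⟨R, hRd, hRi⟩ : ∃ R : KZ.IntegralRep 2, R.domain = B ∧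
      R.integrand = fun z => -(2 * z 0 ^ 2) / (z 1 - z 0 ^ 2 - 5) ^ 2 :=
    ⟨⟨_, _, isSemialgebraic_strip, hg, integrableOn_of_continuousOn_Icc hc strip_subset_Icc⟩,
      rfl, rfl⟩
  -- the honest base representation `T = [(0,1), 2x²(1/(x²+5) − 1/(x²+4))]`
  have hh : IsSemialgebraicFunOn ℚ {y : Fin 1 → ℝ | ∀ i, y i ∈ Set.Ioo (0:ℝ) 1}
      (fun y => 2 * y 0 ^ 2 * (1 / (y 0 ^ 2 + 5) - 1 / (y 0 ^ 2 + 4))) := by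
    refine (isSemialgebraicFunOn_aeval_div_aeval isSemialgebraic_interval
      (-(2 * MvPolynomial.X 0 ^ 2) : MvPolynomial (Fin 1) ℚ)
      ((MvPolynomial.X 0 ^ 2 + 5) * (MvPolynomial.X 0 ^ 2 + 4)) fun y _ => ?_).congr
      fun y _ => ?_
    · simp only [map_mul, map_add, map_pow, MvPolynomial.aeval_X, map_ofNat]
      positivity
    · simp only [map_neg, map_mul, map_add, map_pow, MvPolynomial.aeval_X, map_ofNat]
      field_simp
      ring
  have hcT : ContinuousOn
      (fun y : Fin 1 → ℝ => 2 * y 0 ^ 2 * (1 / (y 0 ^ 2 + 5) - 1 / (y 0 ^ 2 + 4))) (Icc 0 1) :=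
    ContinuousOn.mul (by fun_prop)
      ((continuousOn_const.div (by fun_prop) fun y _ => by positivity).sub
        (continuousOn_const.div (by fun_prop) fun y _ => by positivity))
  obtain ⟨T, hTd, hTi⟩ : ∃ T : KZ.IntegralRep 1,
      T.domain = {y : Fin 1 → ℝ | ∀ i, y i ∈ Set.Ioo (0:ℝ) 1} ∧
      T.integrand = fun y => 2 * y 0 ^ 2 * (1 / (y 0 ^ 2 + 5) - 1 / (y 0 ^ 2 + 4)) :=
    ⟨⟨_, _, isSemialgebraic_interval, hh, integrableOn_of_continuousOn_Icc hcT interval_subset_Icc⟩,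
      rfl, rfl⟩
  -- the primitive `2x²/H` along `y`
  have hG : IsSemialgebraicFunOn ℚ B (fun z => 2 * z 0 ^ 2 / (z 1 - z 0 ^ 2 - 5)) := by
    refine (isSemialgebraicFunOn_aeval_div_aeval isSemialgebraic_strip
      (2 * MvPolynomial.X 0 ^ 2 : MvPolynomial (Fin 2) ℚ)
      (MvPolynomial.X 1 - MvPolynomial.X 0 ^ 2 - 5) fun z hz => ?_).congr fun z _ => ?_
    · simpa using den_ne_zero (z 0) (mem_strip_iff.1 hz).2.2
    · simp
  -- ONE Newton–Leibniz move along `y`: `[R] − [T]`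
  have hNL : KZ.of R - KZ.of T ∈ KZ.relations := by
    refine KZ.newtonLeibnizRel_subset_relations ⟨1, R, T, fun _ => 0, fun _ => 1,
      fun z => 2 * z 0 ^ 2 / (z 1 - z 0 ^ 2 - 5), by rw [hRd]; exact hG,
      by rw [hTd]; exact isSemialgebraicFunOn_zero, by rw [hTd]; exact isSemialgebraicFunOn_one,
      fun _ _ => zero_le_one, by rw [hRd, hTd]; rfl, fun x _ => ?_, fun x _ t ht => ?_,
      fun x _ => ?_, rfl⟩
    · -- continuity of `t ↦ G (x, t)` on `[0, 1]`
      show ContinuousOn (fun t : ℝ => 2 * x 0 ^ 2 / (t - x 0 ^ 2 - 5)) (Icc 0 1)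
      exact continuousOn_const.div (by fun_prop) fun t ht => den_ne_zero (x 0) ht.2
    · -- `∂ₜ G (x, t) = −2x²/(t − x² − 5)²`
      rw [hRi]
      show HasDerivAt (fun s : ℝ => 2 * x 0 ^ 2 / (s - x 0 ^ 2 - 5))
        (-(2 * x 0 ^ 2) / (t - x 0 ^ 2 - 5) ^ 2) t
      have hD : HasDerivAt (fun s : ℝ => s - x 0 ^ 2 - 5) 1 t :=
        ((hasDerivAt_id' t).sub_const _).sub_const _
      exact ((hasDerivAt_const t (2 * x 0 ^ 2)).div hD (den_ne_zero (x 0) ht.2.le)).congr_deriv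
        (by ring)
    · -- the boundary term `G (x, 1) − G (x, 0)`
      rw [hTi]
      show 2 * x 0 ^ 2 * (1 / (x 0 ^ 2 + 5) - 1 / (x 0 ^ 2 + 4)) =
        2 * x 0 ^ 2 / (1 - x 0 ^ 2 - 5) - 2 * x 0 ^ 2 / (0 - x 0 ^ 2 - 5)
      have e1 : (1 : ℝ) - x 0 ^ 2 - 5 = -(x 0 ^ 2 + 4) := by ring
      have e2 : (0 : ℝ) - x 0 ^ 2 - 5 = -(x 0 ^ 2 + 5) := by ring
      rw [e1, e2]
      field_simp
      ring
  -- the two null faces of the band, and the exchange of the pinned `s₁` for `T`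
  have hSR : {z : Fin 2 → ℝ | ∀ i, z i ∈ Set.Ioo (0:ℝ) 1} ⊆ R.domain := by
    rw [hRd]; exact square_subset_strip
  have hnull : KZ.of R - KZ.of (R.restrict _ isSemialgebraic_square hSR) ∈ KZ.relations :=
    R.of_sub_of_restrict_mem_relations isSemialgebraic_square hSR
      (by rw [hRd]; exact volume_strip_diff_square)
  refine ⟨R.restrict _ isSemialgebraic_square hSR, rfl,
    by rw [KZ.IntegralRep.integrand_restrict, hRi], fun s₁ hs₁d hs₁i => ?_⟩
  have h1 : KZ.of s₁ - KZ.of T ∈ KZ.relations :=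
    KZ.of_sub_of_mem_relations_of_eqOn (by rw [hTd, hs₁d]) (by rw [hTi]; exact hs₁i)
  have : KZ.of (R.restrict _ isSemialgebraic_square hSR) - KZ.of s₁ =
      (KZ.of R - KZ.of T) - (KZ.of R - KZ.of (R.restrict _ isSemialgebraic_square hSR)) -
        (KZ.of s₁ - KZ.of T) := by abel
  rw [this]
  exact KZ.relations.sub_mem (KZ.relations.sub_mem hNL hnull) h1

end ParabolaDescends

/-- **`ParabolaDescends` inside the rules** (stub `stub_parabolaDescends` of line `Sketch` for crux
`TateLifting`; verbatim item stmt-KontsevichZagierPeriods-4431 of route `GenericPointClass`):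
for `r = [(0,1)², 1/(y − x² − 5)]`, `s₀ = [(0,1), 1/(y − 6)]`,
`s₁ = [(0,1), 2y²(1/(y²+5) − 1/(y²+4))]` (pinned by domain and integrand on it),
`[r] − [s₀] − [s₁] ∈ KZ.relations`: integrand additivity
`1/H = (1/H + 2x²/H²) + (−2x²/H²)` (`H = y − x² − 5`) followed by the two Newton–Leibniz descents
`ParabolaDescends.piece₁` (along `x`, after a coordinate swap) and `ParabolaDescends.piece₂`
(along `y`). [cite: KontsevichZagier2001, §1.2] -/
theorem tateLifting_parabolaDescends :
    ∀ (r : KZ.IntegralRep 2) (s₀ s₁ : KZ.IntegralRep 1), r.domain = {z | ∀ i, z i ∈ Set.Ioo (0:ℝ) 1} → Set.EqOn r.integrand (fun z => 1 / (z 1 - z 0 ^ 2 - 5)) r.domain → s₀.domain = {y | ∀ i, y i ∈ Set.Ioo (0:ℝ) 1} → Set.EqOn s₀.integrand (fun y => 1 / (y 0 - 6)) s₀.domain → s₁.domain = {y | ∀ i, y i ∈ Set.Ioo (0:ℝ) 1} → Set.EqOn s₁.integrand (fun y => 2 * y 0 ^ 2 * (1 / (y 0 ^ 2 + 5) - 1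 / (y 0 ^ 2 + 4))) s₁.domain → KZ.of r - KZ.of s₀ - KZ.of s₁ ∈ KZ.relations := by
  intro r s₀ s₁ hrd hri hs₀d hs₀i hs₁d hs₁i
  obtain ⟨R₁, hR₁d, hR₁i, hR₁⟩ := ParabolaDescends.piece₁
  obtain ⟨R₂, hR₂d, hR₂i, hR₂⟩ := ParabolaDescends.piece₂
  -- integrand additivity on the open square: `1/H = (1/H + 2x²/H²) + (−2x²/H²)`
  have hadd : KZ.of r - KZ.of R₁ - KZ.of R₂ ∈ KZ.relations := by
    refine KZ.integrandAddRel_subset_relations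
      ⟨2, r, R₁, R₂, by rw [hR₁d, hrd], by rw [hR₂d, hrd], fun z hz => ?_, rfl⟩
    simp only [hri hz, Pi.add_apply, hR₁i, hR₂i]
    ring
  have : KZ.of r - KZ.of s₀ - KZ.of s₁ =
      (KZ.of r - KZ.of R₁ - KZ.of R₂) + (KZ.of R₁ - KZ.of s₀) + (KZ.of R₂ - KZ.of s₁) := by abel
  rw [this]
  exact KZ.relations.add_mem (KZ.relations.add_mem hadd (hR₁ s₀ hs₀d hs₀i)) (hR₂ s₁ hs₁d hs₁i)

end Summit.KontsevichZagierPeriods.InverseLandau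

end
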